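import Summits.BirchSwinnertonDyer.BirchSwinnertonDyer.Theorems.GenusKolyvaginAtTwoTorsionCellSELNegTwistZBits
import Summits.BirchSwinnertonDyer.BirchSwinnertonDyer.Theorems.GenusKolyvaginAtTwoTorsionCellSELNegTwistTorsionData
import HarnessLib

/-!
# SEL (iso-class Selmer pair law), C1-O′: preliminaries for the surjectivity of the parametrisation

Crux R″ `RankOneTwoTorsionResidualAtTwo` (stmt-27478), LINE 49 «full_vertex», SUPPORT stub SEL
`IsoClassSelmerPairLawAtTwo`, the `C₁` half (LEAD memo `Cruxes/…/Lines/torsion_cell_full_vertex_SEL_C1_road_g36.md`, §2–§3).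
Small lemmas for part C1-O: the `𝔽₂` parity solver `zmod2_par_supports`, the residue at `p₀` of an `S`-unit is its sign
(`qrBit_p₀_eq_signBit`), integer kernels of `S`-supported units (`exists_int_kernel`), division in `ℚˣ/ℚˣ²`
(`mk_eq_mul_of_mk_mul_eq`), and the torsion bit data indexed by `τ` recovered from a value disjunction
(`torsionData_of_values`).

Everything is proved; no LINE 49 statement is restated; BSD is not advanced by this file alone.

## References

* [SilvermanAEC2009] J. H. Silverman, *The Arithmetic of Elliptic Curves*, 2nd ed., Prop. X.1.4, Thm. X.4.2, Prop. X.4.9.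
* [Kane2013SelmerTwists] D. M. Kane, Algebra Number Theory 7 (2013), §2.
-/

noncomputable section

open scoped Classical

namespace Summit.BirchSwinnertonDyer.BirchSwinnertonDyer.Theorems.GenusKolyvaginAtTwo.TorsionCellSEL

open WeierstrassCurve WeierstrassCurve.Affine WeierstrassCurve.Affine.Point
open Literature.NumberTheory.GaloisRepresentations Literature.NumberTheory.EllipticCurves Field
open Literature.NumberTheory.EllipticCurves.TwoDescentLocal
open Literature.NumberTheory.EllipticCurves.KramerTwoDescent
open Literature.NumberTheory.QuadraticForms
open Summit.BirchSwinnertonDyer.BirchSwinnertonDyer.Theorems.GenusKolyvaginAtTwo.TorsionCellD0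
open IsDedekindDomain NumberField Rat.HeightOneSpectrum

variable (E : WeierstrassCurve ℚ) [E.IsElliptic] {e₁ e₂ e₃ : ℚ} (S Q : Finset ℕ) {p₀ : ℕ} [hp₀ : Fact p₀.Prime]

/-! ## Small lemmas -/

omit hp₀ in
/-- `𝔽₂`: the two parity relations determine the support sizes. [folklore] -/
theorem zmod2_par_supports (ε s a b : ZMod 2) (h1 : (1 + ε) * a + b = s) (h2 : ε * b + a = s) :
    a = (1 + ε) * s ∧ b = ε * s := by
  revert ε s a b h1 h2; decide

/-- The residue at `p₀` of an `S`-supported integer is its sign (every positive `S`-unit is a square mod `p₀`).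
[cite: Kane2013SelmerTwists, §2] -/
theorem qrBit_p₀_eq_signBit (hS : ∀ ℓ ∈ S, ℓ.Prime) (hp₀S : p₀ ∉ S) (hp8 : p₀ % 8 = 7)
    (hsplitp : ∀ ℓ ∈ S, (hℓ : ℓ.Prime) → ℓ ≠ 2 → haveI : Fact ℓ.Prime := ⟨hℓ⟩; legendreSym ℓ (-(p₀ : ℤ)) = 1)
    (u : ℚˣ) (hsupp : ∀ ℓ : ℕ, (hℓ : ℓ.Prime) → ℓ ∉ S → haveI : Fact ℓ.Prime := ⟨hℓ⟩; parityBit ℓ (u : ℚ) = 0) :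
    qrBit p₀ (u : ℚ) = signBit (u : ℚ) := by
  have hp4 : p₀ % 4 = 3 := by omega
  obtain ⟨T, hTS, η, hη1, hηpos, -, hg, hmk⟩ := exists_kernel_of_parityBit S hS u hsupp
  have hη0 : η ≠ 0 := by rcases hη1 with h1 | h1 <;> rw [h1] <;> norm_num
  have hT0 : ∏ ℓ ∈ T, (ℓ : ℚ) ≠ 0 := Finset.prod_ne_zero_iff.mpr fun ℓ hℓ => by exact_mod_cast (hS ℓ (hTS hℓ)).ne_zero
  rw [qrBit_eq_of_mk_eq p₀ hmk, Units.val_mk0, qrBit_mul p₀ hη0 hT0,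
    qrBit_prod p₀ T (fun ℓ => (ℓ : ℚ)) (fun ℓ hℓ => by exact_mod_cast (hS ℓ (hTS hℓ)).ne_zero)]
  have hzero : ∑ ℓ ∈ T, qrBit p₀ ((ℓ : ℕ) : ℚ) = 0 := by
    refine Finset.sum_eq_zero fun ℓ hℓ => ?_
    have hℓS := hTS hℓ
    have hℓ := hS ℓ hℓS
    by_cases hℓ2 : ℓ = 2
    · subst hℓ2; exact_mod_cast qrBit_two_eq_zero (p := p₀) hp8
    · exact qrBit_prime_eq_zero_of_legendreSym (p := p₀) hp8 hℓ hℓ2 (fun e => hp₀S (e ▸ hℓS)) (hsplitp ℓ hℓS hℓ hℓ2)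
  rw [hzero, add_zero]
  rcases hη1 with h1 | h1
  · rw [h1, qrBit_one, (signBit_eq_zero_iff u.ne_zero).mpr (hηpos.mp h1)]
  · rw [h1, qrBit_neg_one_eq_one_of_emod_four hp4, signBit, if_pos]
    exact lt_of_le_of_ne (not_lt.mp fun hlt => by rw [hηpos.mpr hlt] at h1; norm_num at h1) u.ne_zero

omit hp₀ in
/-- An `S`-supported integer kernel for a unit with even valuations off `S`. [folklore] -/
theorem exists_int_kernel (hS : ∀ ℓ ∈ S, ℓ.Prime) (u : ℚˣ)
    (hsupp : ∀ ℓ : ℕ, (hℓ : ℓ.Prime) → ℓ ∉ S → haveI : Fact ℓ.Prime := ⟨hℓ⟩; parityBit ℓ (u : ℚ) = 0) :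
    ∃ (n : ℤ) (hn0 : (n : ℚ) ≠ 0), (∀ ℓ : ℕ, ℓ.Prime → ℓ ∉ S → ¬ (ℓ : ℤ) ∣ n) ∧
      (QuotientGroup.mk u : SqUnits ℚ) = QuotientGroup.mk (Units.mk0 (n : ℚ) hn0) := by
  obtain ⟨T, hTS, η, hη1, -, -, hg, hmk⟩ := exists_kernel_of_parityBit S hS u hsupp
  have hTp : ∀ ℓ ∈ T, ℓ.Prime := fun ℓ hℓ => hS ℓ (hTS hℓ)
  have hηZ : ∃ e : ℤ, (e : ℚ) = η ∧ (e = 1 ∨ e = -1) := by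
    rcases hη1 with h1 | h1
    · exact ⟨1, by rw [h1]; norm_num, Or.inl rfl⟩
    · exact ⟨-1, by rw [h1]; norm_num, Or.inr rfl⟩
  obtain ⟨e, he, he1⟩ := hηZ
  have hcast : ((e * ∏ ℓ ∈ T, (ℓ : ℤ) : ℤ) : ℚ) = η * ∏ ℓ ∈ T, (ℓ : ℚ) := by rw [← he]; push_cast; rfl
  refine ⟨e * ∏ ℓ ∈ T, (ℓ : ℤ), by rw [hcast]; exact hg, fun q hq hqS hdvd => ?_, ?_⟩
  · have hqprime : Prime (q : ℤ) := Nat.prime_iff_prime_int.mp hq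
    rcases hqprime.dvd_or_dvd hdvd with h1 | h2
    · rcases he1 with rfl | rfl
      · exact hq.one_lt.ne' (by exact_mod_cast Int.eq_one_of_dvd_one (by norm_num) h1)
      · exact hq.one_lt.ne' (by exact_mod_cast Int.eq_one_of_dvd_one (by norm_num) (Int.dvd_neg.mpr h1))
    · obtain ⟨ℓ, hℓT, hℓ⟩ := (Prime.dvd_finsetProd_iff hqprime _).mp h2
      have := (Nat.prime_dvd_prime_iff_eq hq (hTp ℓ hℓT)).mp (by exact_mod_cast hℓ)
      exact hqS (this ▸ hTS hℓT)
  · rw [hmk]; congr 1; exact Units.ext (by rw [Units.val_mk0, Units.val_mk0, hcast])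

omit hp₀ in
/-- In `ℚˣ/ℚˣ²`: `[x·w] = [t] ⟹ [x] = [t·w]`. [folklore] -/
theorem mk_eq_mul_of_mk_mul_eq {x w t : ℚˣ} (h : (QuotientGroup.mk (x * w) : SqUnits ℚ) = QuotientGroup.mk t) :
    (QuotientGroup.mk x : SqUnits ℚ) = QuotientGroup.mk (t * w) := by
  rw [QuotientGroup.mk_mul] at h ⊢
  rw [← h, mul_assoc, SqUnits.mul_self, mul_one]



/-- The torsion bit data indexed by `τ ∈ 𝔽₂²`, recovered from the VALUE disjunction of a torsion pair
(transfer from `exists_torsionUnits`). [cite: SilvermanAEC2009, Prop. X.1.4, Thm. X.4.2] -/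
theorem torsionData_of_values (h : E.toAffine.SplitTwoTorsion e₁ e₂ e₃) (h12 : e₁ < e₂) (h23 : e₂ < e₃)
    (hgood : ∀ ℓ : ℕ, (hℓ : ℓ.Prime) → ℓ ∉ S → haveI : Fact ℓ.Prime := ⟨hℓ⟩;
      padicValRat ℓ (e₁ - e₂) = 0 ∧ padicValRat ℓ (e₁ - e₃) = 0 ∧ padicValRat ℓ (e₂ - e₃) = 0)
    (hQ4 : ∀ q ∈ Q, q % 4 = 3)
    (hadm : ∀ q ∈ Q, (hq : q.Prime) → haveI : Fact q.Prime := ⟨hq⟩;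
      qrBit q ((e₁ - e₂) * (e₁ - e₃)) = 1 ∧ qrBit q ((e₂ - e₁) * (e₂ - e₃)) = 1)
    {ε : ZMod 2} (hε : ∀ q ∈ Q, (hq : q.Prime) → haveI : Fact q.Prime := ⟨hq⟩; qrBit q (e₂ - e₁) = ε)
    (hp₀4 : p₀ % 4 = 3) (hres₀ : qrBit p₀ (e₂ - e₁) = 0 ∧ qrBit p₀ (e₃ - e₁) = 0 ∧ qrBit p₀ (e₃ - e₂) = 0)
    (t₁ t₂ : ℚˣ)
    (htv : ((t₁ : ℚ) = 1 ∧ (t₂ : ℚ) = 1) ∨ ((t₁ : ℚ) = (e₁ - e₂) * (e₁ - e₃) ∧ (t₂ : ℚ) = e₁ - e₂) ∨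
        ((t₁ : ℚ) = e₂ - e₁ ∧ (t₂ : ℚ) = (e₂ - e₁) * (e₂ - e₃)) ∨ ((t₁ : ℚ) = e₃ - e₁ ∧ (t₂ : ℚ) = e₃ - e₂)) :
    ∃ τ₁ τ₂ : ZMod 2,
      ((τ₁ = 0 ∧ τ₂ = 0 ∧ (t₁ : ℚ) = 1 ∧ (t₂ : ℚ) = 1) ∨
        (τ₁ = 1 ∧ τ₂ = 0 ∧ (t₁ : ℚ) = (e₁ - e₂) * (e₁ - e₃) ∧ (t₂ : ℚ) = e₁ - e₂) ∨
        (τ₁ = 0 ∧ τ₂ = 1 ∧ (t₁ : ℚ) = e₂ - e₁ ∧ (t₂ : ℚ) = (e₂ - e₁) * (e₂ - e₃)) ∨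
        (τ₁ = 1 ∧ τ₂ = 1 ∧ (t₁ : ℚ) = e₃ - e₁ ∧ (t₂ : ℚ) = e₃ - e₂)) ∧
      (∀ j ∈ Q, (hj : j.Prime) → haveI : Fact j.Prime := ⟨hj⟩;
        qrBit j (t₁ : ℚ) = τ₁ + ε * τ₂ ∧ qrBit j (t₂ : ℚ) = (1 + ε) * τ₁ + τ₂) ∧
      qrBit p₀ (t₁ : ℚ) = 0 ∧ qrBit p₀ (t₂ : ℚ) = τ₁ + τ₂ ∧ signBit (t₁ : ℚ) = 0 ∧ signBit (t₂ : ℚ) = τ₁ + τ₂ := by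
  have htor := fun τ₁ τ₂ : ZMod 2 => exists_torsionUnits E S Q h h12 h23 hgood hQ4 hadm hε hp₀4 hres₀ τ₁ τ₂
  -- transfer the bit data from `exists_torsionUnits` along equality of values
  have transfer : ∀ (τ₁ τ₂ : ZMod 2) (u₁ u₂ : ℚˣ), (u₁ : ℚ) = (t₁ : ℚ) → (u₂ : ℚ) = (t₂ : ℚ) →
      ((∀ j ∈ Q, (hj : j.Prime) → haveI : Fact j.Prime := ⟨hj⟩;
          qrBit j (u₁ : ℚ) = τ₁ + ε * τ₂ ∧ qrBit j (u₂ : ℚ) = (1 + ε) * τ₁ + τ₂) ∧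
        qrBit p₀ (u₁ : ℚ) = 0 ∧ qrBit p₀ (u₂ : ℚ) = τ₁ + τ₂ ∧ signBit (u₁ : ℚ) = 0 ∧ signBit (u₂ : ℚ) = τ₁ + τ₂) →
      ((∀ j ∈ Q, (hj : j.Prime) → haveI : Fact j.Prime := ⟨hj⟩;
          qrBit j (t₁ : ℚ) = τ₁ + ε * τ₂ ∧ qrBit j (t₂ : ℚ) = (1 + ε) * τ₁ + τ₂) ∧
        qrBit p₀ (t₁ : ℚ) = 0 ∧ qrBit p₀ (t₂ : ℚ) = τ₁ + τ₂ ∧ signBit (t₁ : ℚ) = 0 ∧ signBit (t₂ : ℚ) = τ₁ + τ₂) := by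
    intro τ₁ τ₂ u₁ u₂ e1 e2 hdat
    rw [e1, e2] at hdat; exact hdat
  rcases htv with ⟨a1, a2⟩ | ⟨a1, a2⟩ | ⟨a1, a2⟩ | ⟨a1, a2⟩
  · obtain ⟨u₁, u₂, hdisj, -, -, hdat⟩ := htor 0 0
    have hv : (u₁ : ℚ) = 1 ∧ (u₂ : ℚ) = 1 := by
      rcases hdisj with ⟨-, -, v1, v2⟩ | ⟨h1, -⟩ | ⟨-, h1, -⟩ | ⟨h1, -⟩
      · exact ⟨v1, v2⟩
      all_goals exact absurd h1 zero_ne_one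
    exact ⟨0, 0, Or.inl ⟨rfl, rfl, a1, a2⟩, transfer 0 0 u₁ u₂ (hv.1.trans a1.symm) (hv.2.trans a2.symm) hdat⟩
  · obtain ⟨u₁, u₂, hdisj, -, -, hdat⟩ := htor 1 0
    have hv : (u₁ : ℚ) = (e₁ - e₂) * (e₁ - e₃) ∧ (u₂ : ℚ) = e₁ - e₂ := by
      rcases hdisj with ⟨h1, -⟩ | ⟨-, -, v1, v2⟩ | ⟨h1, -⟩ | ⟨-, h1, -⟩
      · exact absurd h1 one_ne_zero
      · exact ⟨v1, v2⟩
      · exact absurd h1 one_ne_zero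
      · exact absurd h1 zero_ne_one
    exact ⟨1, 0, Or.inr (Or.inl ⟨rfl, rfl, a1, a2⟩), transfer 1 0 u₁ u₂ (hv.1.trans a1.symm) (hv.2.trans a2.symm) hdat⟩
  · obtain ⟨u₁, u₂, hdisj, -, -, hdat⟩ := htor 0 1
    have hv : (u₁ : ℚ) = e₂ - e₁ ∧ (u₂ : ℚ) = (e₂ - e₁) * (e₂ - e₃) := by
      rcases hdisj with ⟨-, h1, -⟩ | ⟨h1, -⟩ | ⟨-, -, v1, v2⟩ | ⟨h1, -⟩
      · exact absurd h1 one_ne_zero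
      · exact absurd h1 zero_ne_one
      · exact ⟨v1, v2⟩
      · exact absurd h1 zero_ne_one
    exact ⟨0, 1, Or.inr (Or.inr (Or.inl ⟨rfl, rfl, a1, a2⟩)),
      transfer 0 1 u₁ u₂ (hv.1.trans a1.symm) (hv.2.trans a2.symm) hdat⟩
  · obtain ⟨u₁, u₂, hdisj, -, -, hdat⟩ := htor 1 1
    have hv : (u₁ : ℚ) = e₃ - e₁ ∧ (u₂ : ℚ) = e₃ - e₂ := by
      rcases hdisj with ⟨h1, -⟩ | ⟨-, h1, -⟩ | ⟨h1, -⟩ | ⟨-, -, v1, v2⟩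
      · exact absurd h1 one_ne_zero
      · exact absurd h1 one_ne_zero
      · exact absurd h1 one_ne_zero
      · exact ⟨v1, v2⟩
    exact ⟨1, 1, Or.inr (Or.inr (Or.inr ⟨rfl, rfl, a1, a2⟩)),
      transfer 1 1 u₁ u₂ (hv.1.trans a1.symm) (hv.2.trans a2.symm) hdat⟩

end Summit.BirchSwinnertonDyer.BirchSwinnertonDyer.Theorems.GenusKolyvaginAtTwo.TorsionCellSEL

end
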